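import Summits.QuantumFields.GaugeBoot.DiagonalRPTorusTwoGeometry
import Summits.QuantumFields.GaugeBoot.DiagonalRPTorusTwoHaar
import HarnessLib

/-!
# Diagonal RP on the two-dimensional torus: the degenerate cases `L = 2` and `β = 0`
(gauge-boot, task L3(δ))

HONEST FRAMING (cell `pub-gaugeboot`, page 1 of every file): the venture produces certified bounds
on lattice expectations at stated coupling, gauge group, dimension and torus size; NOT a mass gap,
NOT a continuum limit, NOT a string tension; NOT Yang–Mills-summit-bearing (barriers
`FixedCouplingUltralocality`, `PerturbativeInvisibility`). This module is part of a small NEGATIVE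
result about which positivity constraints a TORUS certificate may use; it discharges nothing else.

Companion of `DiagonalRPTorusNegativeTwo.lean` (`L ≥ 4`, `β ≠ 0`: FAILS, dynamical obstruction)
and `DiagonalRPTorusNegative.lean` (`d ≥ 3`: FAILS at every `β`, geometric obstruction):

* `L = 2`: on the `2 × 2` torus the closed diagonal half `{(y_i - y_j) mod 2 ≤ 1}` is everything
  and the swap exchanges the distinct links `(0, i)`, `(0, j)`, so the geometric witness of `d ≥ 3`
  applies verbatim — **`exists_wilsonExpectation_neg_two_two`** (an odd bounded observable with
  `⟨(ΘF)‾F⟩ = -⟨|F|²⟩ < 0` at every `β`, for every non-trivial compact Hausdorff `G`) and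
  **`not_diagonalReflectionPositive_two_two`**;
* `β = 0`, `L ≥ 4`: the two closed halves have NO link in common (`not_inHalf_edgeDiagSwap`), so
  a half observable and its swap are independent under product Haar measure with equal means and
  `⟨(ΘF)‾F⟩_{Λ,0} = |∫F|² ≥ 0` — **`diagonalReflectionPositive_zero`** (for every `ρ`). With
  `not_diagonalReflectionPositive_two` this pins the `d = 2` phenomenon down as DYNAMICAL: for a
  representation with non-constant character, closed-half diagonal RP on `(ℤ/L)²`, `L ≥ 4` even,
  holds if and only if `β = 0`.

Also here (for file-size reasons): **`sign_Q`** — with the bump `φ`, radius `δ` and sign `s` of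
`exists_bump` (`DiagonalRPTorusTwoHaar.lean`) and `φ₀ = φ - ∫φ`, the two-link quantity
`Q = ∫ κ(U_a U_{a'}⁻¹) φ₀(U_a) φ₀(U_{a'}) dπ` satisfies `s Q < 0`; this is the sign input of
`DiagonalRPTorusNegativeTwo.lean`. All statements are proved.
-/

open MeasureTheory Complex Finset Function
open scoped ComplexOrder ENNReal

namespace Summit.QuantumFields.GaugeBoot

open Literature.MathematicalPhysics.QuantumFieldTheory
open Literature.RepresentationTheory.CompactGroups

noncomputable section

namespace DiagRPTwo

/-! ## The degenerate torus `L = 2`: the geometric obstruction -/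

section TwoByTwo

variable {N : ℕ} {G : Type*} [Group G] [TopologicalSpace G] [IsTopologicalGroup G]
  [CompactSpace G] [MeasurableSpace G] [BorelSpace G] (ρ : G →* Matrix (Fin N) (Fin N) ℂ)

/-- **`L = 2`.** On the `2 × 2` torus the closed diagonal half is everything (`(y_i - y_j) mod 2 ≤
1`
always), and the swap exchanges the two distinct links `(0, i)` and `(0, j)`; so, exactly as in
`d ≥ 3` (`exists_diagonalLayerObservable_wilsonExpectation_neg`), `F(U) = g(U(0,i)) - g(U(0,j))`
with `g` continuous separating two points of `G` is swap-odd and `⟨(ΘF)‾ F⟩ = -⟨|F|²⟩ < 0`, at EVERY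
`β` and for every non-trivial compact Hausdorff `G`. -/
theorem exists_wilsonExpectation_neg_two_two [Nontrivial G] [T2Space G] (hρ : Continuous ρ)
    (β : ℝ) {i j : Fin 2} (hij : i ≠ j) :
    ∃ F : GaugeConfig 2 2 G → ℂ, Measurable F ∧ (∀ U, ‖F U‖ ≤ 1) ∧
      IsDiagonalHalfObservable i j F ∧ (∀ U, F (configDiagSwap i j U) = -F U) ∧
      wilsonExpectation ρ β (fun U => (starRingEnd ℂ) (F (configDiagSwap i j U)) * F U) < 0 := by
  set e₁ : Edge 2 2 := (0, i) with he₁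
  set e₂ : Edge 2 2 := (0, j) with he₂
  have hne : e₁ ≠ e₂ := fun h0 => hij (Prod.ext_iff.1 h0).2
  have hθ0 : siteDiagSwap i j (0 : Site 2 2) = 0 := by
    funext k; simp [siteDiagSwap]
  have hsw₁ : edgeDiagSwap i j e₁ = e₂ := by
    rw [he₁, he₂, edgeDiagSwap]; simp only [hθ0, Equiv.swap_apply_left]
  have hsw₂ : edgeDiagSwap i j e₂ = e₁ := by
    rw [he₁, he₂, edgeDiagSwap]; simp only [hθ0, Equiv.swap_apply_right]
  obtain ⟨a, b, hab⟩ := exists_pair_ne G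
  obtain ⟨g, hga, hgb, hg01⟩ := exists_continuous_zero_one_of_isClosed
    (isClosed_singleton (x := a)) (isClosed_singleton (x := b)) (Set.disjoint_singleton.2 hab)
  set h : GaugeConfig 2 2 G → ℝ := fun U => g (U e₁) - g (U e₂) with hh
  have hh_meas : Measurable h :=
    (g.continuous.measurable.comp (measurable_pi_apply e₁)).sub
      (g.continuous.measurable.comp (measurable_pi_apply e₂))
  have hh_bound : ∀ U, |h U| ≤ 1 := fun U => by
    rw [hh, abs_sub_le_iff]
    constructor <;> linarith [(hg01 (U e₁)).1, (hg01 (U e₁)).2, (hg01 (U e₂)).1, (hg01 (U e₂)).2]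
  have hh_odd : ∀ U, h (configDiagSwap i j U) = -h U := fun U => by
    simp only [hh, configDiagSwap, hsw₁, hsw₂]
    ring
  refine ⟨fun U => (h U : ℂ), Complex.measurable_ofReal.comp hh_meas, fun U => ?_, ?_,
    fun U => ?_, ?_⟩
  · rw [Complex.norm_real, Real.norm_eq_abs]
    exact hh_bound U
  · -- every link of the `2 × 2` torus lies in the closed half
    intro U V hUV
    have hUV' : U = V := funext fun e => hUV e
      (by have := ZMod.val_lt (e.1 i - e.1 j); omega)
      (by have := ZMod.val_lt ((e.1.shift e.2) i - (e.1.shift e.2) j); omega)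
    rw [hUV']
  · show ((h (configDiagSwap i j U) : ℝ) : ℂ) = -((h U : ℝ) : ℂ)
    rw [hh_odd]
    push_cast
    ring
  · have hint : (fun U => (starRingEnd ℂ) ((h (configDiagSwap i j U) : ℝ) : ℂ) * (h U : ℂ)) =
        fun U => ((-(h U ^ 2) : ℝ) : ℂ) := by
      funext U
      rw [Complex.conj_ofReal, hh_odd]
      push_cast
      ring
    rw [hint, wilsonExpectation_ofReal_eq ρ hρ β, ← Complex.ofReal_zero, Complex.real_lt_real]
    set O : Set (GaugeConfig 2 2 G) :=
      (fun U : GaugeConfig 2 2 G => U e₁) ⁻¹' (g ⁻¹' Set.Iio (1 / 2 : ℝ)) ∩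
        (fun U : GaugeConfig 2 2 G => U e₂) ⁻¹' (g ⁻¹' Set.Ioi (1 / 2 : ℝ)) with hOdef
    have hO : IsOpen O :=
      ((isOpen_Iio.preimage g.continuous).preimage (continuous_apply e₁)).inter
        ((isOpen_Ioi.preimage g.continuous).preimage (continuous_apply e₂))
    have hOne : O.Nonempty := by
      refine ⟨Function.update (fun _ => a) e₂ b, ?_, ?_⟩
      · simp only [Set.mem_preimage, Function.update_of_ne hne, hga rfl, Set.mem_Iio]; norm_num
      · simp only [Set.mem_preimage, Function.update_self, hgb rfl, Set.mem_Ioi]; norm_num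
    have hOh : ∀ U ∈ O, h U ≠ 0 := by
      rintro U ⟨h1, h2⟩
      simp only [Set.mem_preimage, Set.mem_Iio, Set.mem_Ioi] at h1 h2
      show g (U e₁) - g (U e₂) ≠ 0
      exact (by linarith : g (U e₁) - g (U e₂) < 0).ne
    have hpos := integral_exp_mul_sq_pos (d := 2) (L := 2) ρ hρ β hh_meas hh_bound hO hOne hOh
    have hrw : (fun U : GaugeConfig 2 2 G => Real.exp (-β * wilsonAction ρ U) * -(h U ^ 2)) =
        fun U => -(Real.exp (-β * wilsonAction ρ U) * h U ^ 2) := funext fun U => by ring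
    rw [hrw, integral_neg, mul_neg]
    linarith

/-- `L = 2`, corollary: `¬ DiagonalReflectionPositive` on the `2 × 2` torus at every `β`. -/
theorem not_diagonalReflectionPositive_two_two [Nontrivial G] [T2Space G] (hρ : Continuous ρ)
    (β : ℝ) {i j : Fin 2} (hij : i ≠ j) :
    ¬ DiagonalReflectionPositive (d := 2) (L := 2) ρ β i j := by
  intro hRP
  obtain ⟨F, hF, hFb, hFH, -, hneg⟩ := exists_wilsonExpectation_neg_two_two ρ hρ β hij
  exact lt_irrefl _ (lt_of_le_of_lt (hRP F hF ⟨1, hFb⟩ hFH) hneg)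

end TwoByTwo

/-! ## `β = 0`, `L ≥ 4`: the two closed halves are independent and swap-RP holds -/

section BetaZero

variable {L N : ℕ} [NeZero L] {G : Type*} [Group G] [TopologicalSpace G] [IsTopologicalGroup G]
  [CompactSpace G] [MeasurableSpace G] [BorelSpace G] (ρ : G →* Matrix (Fin N) (Fin N) ℂ)

/-- At `β = 0` the Wilson measure of the torus is product Haar measure (for every `ρ`). -/
theorem wilsonMeasure_zero : wilsonMeasure (d := 2) (L := L) ρ 0 = (linkMeasure L G) := by
  have hw : wilsonWeight (d := 2) (L := L) ρ 0 = (linkMeasure L G) := by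
    unfold wilsonWeight
    have h1 : (fun U : GaugeConfig 2 L G => ENNReal.ofReal (Real.exp (-0 * wilsonAction ρ U))) =
        1 := by
      funext U; simp
    rw [h1, withDensity_one]
  unfold wilsonMeasure partitionFunction
  rw [hw, measure_univ, inv_one, one_smul]

/-- The swap of links as a permutation (an involution). -/
def swapPerm (i j : Fin 2) : Equiv.Perm (Edge 2 L) :=
  Function.Involutive.toPerm (edgeDiagSwap i j) (edgeDiagSwap_edgeDiagSwap i j)

omit [NeZero L] [Group G] [TopologicalSpace G] [IsTopologicalGroup G] [CompactSpace G]
  [BorelSpace G] in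
/-- The swap of configurations is the relabelling of the links by `swapPerm`. -/
theorem coe_piCongrLeft_swapPerm (i j : Fin 2) :
    ⇑(MeasurableEquiv.piCongrLeft (fun _ : Edge 2 L => G) (swapPerm (L := L) i j)) =
      configDiagSwap (G := G) i j := by
  funext U e
  rw [MeasurableEquiv.coe_piCongrLeft]
  have h1 := Equiv.piCongrLeft_apply_apply (P := fun _ : Edge 2 L => G) (e := swapPerm (L := L) i j)
    U ((swapPerm (L := L) i j).symm e)
  rw [Equiv.apply_symm_apply] at h1
  rw [h1]
  rfl

/-- The swap preserves product Haar measure. -/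
theorem measurePreserving_configDiagSwap (i j : Fin 2) :
    MeasurePreserving (configDiagSwap (G := G) (L := L) i j) (linkMeasure L G) (linkMeasure L G) :=
        by
  have h := MeasureTheory.measurePreserving_piCongrLeft (fun _ : Edge 2 L => haarProbability G)
    (swapPerm (L := L) i j)
  rwa [coe_piCongrLeft_swapPerm] at h

/-- `∫ F(ΘU) dπ = ∫ F dπ`. -/
theorem integral_comp_configDiagSwap (i j : Fin 2) (F : GaugeConfig 2 L G → ℂ) :
    ∫ U, F (configDiagSwap i j U) ∂(linkMeasure L G) = ∫ U, F U ∂(linkMeasure L G) := by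
  have h := integral_map_equiv (μ := (linkMeasure L G))
    (MeasurableEquiv.piCongrLeft (fun _ : Edge 2 L => G) (swapPerm (L := L) i j)) F
  rw [(MeasureTheory.measurePreserving_piCongrLeft (fun _ : Edge 2 L => haarProbability G)
    (swapPerm (L := L) i j)).map_eq, coe_piCongrLeft_swapPerm] at h
  exact h.symm

open Classical in
/-- The links of the closed diagonal half. -/
def halfLinks (i j : Fin 2) : Finset (Edge 2 L) := univ.filter (InHalf i j)

/-- Membership in `halfLinks`. -/
theorem mem_halfLinks {i j : Fin 2} {e : Edge 2 L} :
    e ∈ halfLinks i j ↔ InHalf i j e := by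
  classical
  simp [halfLinks]

omit [Group G] [TopologicalSpace G] [IsTopologicalGroup G] [CompactSpace G] [MeasurableSpace G]
  [BorelSpace G] in
/-- A half observable depends only on the half links. -/
theorem dependsOn_halfLinks {α : Type*} {i j : Fin 2} {F : GaugeConfig 2 L G → α}
    (hF : IsDiagonalHalfObservable i j F) :
    DependsOn F (halfLinks (L := L) i j : Set (Edge 2 L)) :=
  fun U V hUV => hF U V fun e h1 h2 => hUV e (Finset.mem_coe.2 (mem_halfLinks.2 ⟨h1, h2⟩))

omit [Group G] [TopologicalSpace G] [IsTopologicalGroup G] [CompactSpace G] [MeasurableSpace G]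
  [BorelSpace G] in
/-- Its swap depends only on the swapped half links. -/
theorem dependsOn_comp_configDiagSwap {α : Type*} {i j : Fin 2} {F : GaugeConfig 2 L G → α}
    (hF : DependsOn F (halfLinks (L := L) i j : Set (Edge 2 L))) :
    DependsOn (fun U => F (configDiagSwap i j U))
      ((halfLinks (L := L) i j).image (edgeDiagSwap i j) : Set (Edge 2 L)) :=
  fun _ _ hUV => hF fun e he =>
    hUV (edgeDiagSwap i j e) (Finset.mem_coe.2 (Finset.mem_image_of_mem _ he))

/-- A residue whose own and whose negative's representatives are both `≤ L/2` is `0` or `L/2`. -/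
theorem val_eq_of_val_le_val_neg_le (hL : Even L) {k : ZMod L} (h1 : k.val ≤ L / 2)
    (h2 : (-k).val ≤ L / 2) : k.val = 0 ∨ k.val = L / 2 := by
  obtain ⟨r, hr⟩ := hL
  by_cases hk : k = 0
  · left; rw [hk, ZMod.val_zero]
  · right
    rw [val_neg_of_ne_zero' hk] at h2
    have := ZMod.val_lt k
    omega

/-- For `L ≥ 4` no link of the closed half is swapped into the closed half: the two closed halves
have no link in common. -/
theorem not_inHalf_edgeDiagSwap (hL : Even L) (h4 : 4 ≤ L) {i j : Fin 2} (hij : i ≠ j)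
    {e : Edge 2 L} (he : InHalf i j e) : ¬InHalf i j (edgeDiagSwap i j e) := by
  intro he'
  obtain ⟨y, μ⟩ := e
  rcases he with ⟨ha, hb⟩
  rcases he' with ⟨ha', hb'⟩
  simp only [edgeDiagSwap] at ha' hb'
  rw [kd_siteDiagSwap] at ha'
  rw [← siteDiagSwap_shift, kd_siteDiagSwap] at hb'
  have hva := val_eq_of_val_le_val_neg_le hL ha ha'
  have hvb := val_eq_of_val_le_val_neg_le hL hb hb'
  rcases (by decide : ∀ a b c : Fin 2, a ≠ b → c = a ∨ c = b) i j μ hij with hμ | hμ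
  · -- a step in direction `i`: `k ↦ k + 1`
    rw [hμ, kd_shift_left hij] at hvb hb
    rcases hva with h0 | hc
    · rw [val_add_one_of_lt h4 (by rw [h0]; omega), h0] at hvb; omega
    · have : (kd i j y + 1).val = L / 2 + 1 := by
        rw [ZMod.val_add_of_lt, val_one_of_four_le h4, hc]
        rw [val_one_of_four_le h4, hc]; omega
      rw [this] at hb; omega
  · -- a step in direction `j`: `k ↦ k - 1`
    rw [hμ, kd_shift_right hij] at hvb hb
    rcases hva with h0 | hc
    · have hk0 : kd i j y = 0 := (ZMod.val_eq_zero _).1 h0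
      have h10 : (1 : ZMod L) ≠ 0 := by
        intro h; have := val_one_of_four_le h4; rw [h, ZMod.val_zero] at this; omega
      rw [hk0, zero_sub, val_neg_of_ne_zero' h10, val_one_of_four_le h4] at hb; omega
    · rw [val_sub_one_of_pos h4 (by rw [hc]; omega), hc] at hvb; omega

/-- The half links and their swaps are disjoint (`L ≥ 4`). -/
theorem disjoint_halfLinks_image (hL : Even L) (h4 : 4 ≤ L) {i j : Fin 2} (hij : i ≠ j) :
    Disjoint ((halfLinks i j).image (edgeDiagSwap i j)) (halfLinks (L := L) i j) := by
  rw [Finset.disjoint_left]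
  intro e he he'
  obtain ⟨e₀, he₀, rfl⟩ := Finset.mem_image.1 he
  exact not_inHalf_edgeDiagSwap hL h4 hij (mem_halfLinks.1 he₀) (mem_halfLinks.1 he')

/-- **`β = 0`: diagonal reflection positivity HOLDS on the two-dimensional even torus `L ≥ 4`**
(for every `ρ`): a half observable and its swap depend on disjoint sets of links, hence are
independent under product Haar measure with equal means, so `⟨(ΘF)‾ F⟩ = |∫F|² ≥ 0`. Together with
`not_diagonalReflectionPositive_two`: for a representation with non-constant character, diagonal
RP on `(ℤ/L)²`, `L ≥ 4` even, holds iff `β = 0`. -/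
theorem diagonalReflectionPositive_zero (hL : Even L) (h4 : 4 ≤ L) {i j : Fin 2} (hij : i ≠ j) :
    DiagonalReflectionPositive (d := 2) (L := L) ρ 0 i j := by
  intro F hF _ hFH
  rw [wilsonExpectation, wilsonMeasure_zero]
  have hΘm : Measurable (configDiagSwap (G := G) (L := L) i j) :=
    measurable_pi_lambda _ fun e => measurable_pi_apply _
  have hdep := dependsOn_halfLinks hFH
  have h1 : ∫ U, (starRingEnd ℂ) (F (configDiagSwap i j U)) * F U ∂(linkMeasure L G) =
      (∫ U, (starRingEnd ℂ) (F (configDiagSwap i j U)) ∂(linkMeasure L G)) * ∫ U, F U ∂(linkMeasure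
          L G) :=
    LatticeRP.integral_mul_eq_of_dependsOn (haarProbability G) _ _
      (disjoint_halfLinks_image hL h4 hij) (Complex.continuous_conj.measurable.comp (hF.comp hΘm))
          hF
      (fun U V hUV => congrArg (starRingEnd ℂ) (dependsOn_comp_configDiagSwap hdep hUV)) hdep
  rw [h1, integral_conj, integral_comp_configDiagSwap]
  rw [← Complex.star_def]
  exact star_mul_self_nonneg _

end BetaZero

/-! ## The sign of the two-link quantity `Q` -/

section SignQ

variable {L N : ℕ} [NeZero L] {G : Type*} [Group G] [TopologicalSpace G] [IsTopologicalGroup G]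
  [CompactSpace G] [MeasurableSpace G] [BorelSpace G] [SecondCountableTopology G]
  (ρ : G →* Matrix (Fin N) (Fin N) ℂ)

/-- **`s · Q < 0`.** With the bump `φ`, radius `δ` and sign `s` of `exists_bump` and
`φ₀ = φ - ∫φ`: `s ∫ κ(U_a U_{a'}⁻¹) φ₀(U_a) φ₀(U_{a'}) dπ < 0` for distinct links `a ≠ a'`. -/
theorem sign_Q (hρ : Continuous ρ) (β : ℝ) {a a' : Edge 2 L} (haa : a ≠ a') {φ : G → ℝ}
    {δ s : ℝ} (hφc : Continuous φ) (hφ0 : ∀ x, 0 ≤ φ x) (hφ1 : ∀ x, φ x ≤ 1)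
    (hs : s = 1 ∨ s = -1) (hm : 0 < ∫ x, φ x ∂(haarProbability G))
    (hV : ∀ x y, φ x ≠ 0 → φ y ≠ 0 → |κ ρ β (x * y⁻¹) - κ ρ β 1| ≤ δ)
    (hsign : s * (κ ρ β 1 - ∫ x, κ ρ β x ∂(haarProbability G)) + δ < 0) :
    s * ∫ U, κ ρ β (U a * (U a')⁻¹) *
      ((φ (U a) - ∫ x, φ x ∂(haarProbability G)) * (φ (U a') - ∫ x, φ x ∂(haarProbability G)))
          ∂(linkMeasure L G) < 0 := by
  set m : ℝ := ∫ x, φ x ∂(haarProbability G) with hm_def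
  set c₀ : ℝ := ∫ x, κ ρ β x ∂(haarProbability G) with hc₀
  have hκm : Measurable (κ ρ β) := (continuous_κ ρ hρ β).measurable
  have hφm : Measurable φ := hφc.measurable
  set K : ℝ := Real.exp (|β| * N) with hK
  have hκb : ∀ x, |κ ρ β x| ≤ K := abs_κ_le ρ hρ β
  have hK0 : 0 ≤ K := (abs_nonneg _).trans (hκb 1)
  have hφb : ∀ x, |φ x| ≤ 1 := fun x => by rw [abs_of_nonneg (hφ0 x)]; exact hφ1 x
  -- the pieces
  have hker : Measurable fun U : GaugeConfig 2 L G => κ ρ β (U a * (U a')⁻¹) :=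
    hκm.comp ((measurable_pi_apply a).mul (measurable_pi_apply a').inv)
  have hφa : Measurable fun U : GaugeConfig 2 L G => φ (U a) := hφm.comp (measurable_pi_apply a)
  have hφa' : Measurable fun U : GaugeConfig 2 L G => φ (U a') :=
    hφm.comp (measurable_pi_apply a')
  have iT : Integrable (fun U : GaugeConfig 2 L G => κ ρ β (U a * (U a')⁻¹)) (linkMeasure L G) :=
    integrable_of_abs_le hker (fun U => hκb _)
  have iR1 : Integrable (fun U : GaugeConfig 2 L G => κ ρ β (U a * (U a')⁻¹) * φ (U a))
      (linkMeasure L G) :=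
    integrable_of_abs_le (hker.mul hφa) (B := K) fun U => by
      rw [abs_mul]
      exact (mul_le_mul (hκb _) (hφb _) (abs_nonneg _) hK0).trans (by rw [mul_one])
  have iR2 : Integrable (fun U : GaugeConfig 2 L G => κ ρ β (U a * (U a')⁻¹) * φ (U a'))
      (linkMeasure L G) :=
    integrable_of_abs_le (hker.mul hφa') (B := K) fun U => by
      rw [abs_mul]
      exact (mul_le_mul (hκb _) (hφb _) (abs_nonneg _) hK0).trans (by rw [mul_one])
  have iP : Integrable
      (fun U : GaugeConfig 2 L G => κ ρ β (U a * (U a')⁻¹) * (φ (U a) * φ (U a'))) (linkMeasure L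
          G) :=
    integrable_of_abs_le (hker.mul (hφa.mul hφa')) (B := K) fun U => by
      rw [abs_mul, abs_mul]
      have : |φ (U a)| * |φ (U a')| ≤ 1 := by
        calc |φ (U a)| * |φ (U a')| ≤ 1 * 1 :=
              mul_le_mul (hφb _) (hφb _) (abs_nonneg _) zero_le_one
          _ = 1 := one_mul 1
      exact (mul_le_mul (hκb _) this (mul_nonneg (abs_nonneg _) (abs_nonneg _)) hK0).trans
        (by rw [mul_one])
  have hT : ∫ U, κ ρ β (U a * (U a')⁻¹) ∂(linkMeasure L G) = c₀ := integral_kernel haa hκm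
  have hR1 : ∫ U, κ ρ β (U a * (U a')⁻¹) * φ (U a) ∂(linkMeasure L G) = c₀ * m :=
    integral_kernel_mul_left haa hκm (κ_inv ρ hρ β) hφm
  have hR2 : ∫ U, κ ρ β (U a * (U a')⁻¹) * φ (U a') ∂(linkMeasure L G) = c₀ * m :=
    integral_kernel_mul_right haa hκm hφm
  obtain ⟨hPlo, hPhi⟩ := integral_kernel_mul_mul_bounds (L := L) haa hκm hφm hκb hφ0 hφ1 hV
  set Qφ : ℝ := ∫ U, κ ρ β (U a * (U a')⁻¹) * (φ (U a) * φ (U a')) ∂(linkMeasure L G) with hQφ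
  -- expand
  have hexp : (fun U : GaugeConfig 2 L G =>
      κ ρ β (U a * (U a')⁻¹) * ((φ (U a) - m) * (φ (U a') - m))) =
      fun U => κ ρ β (U a * (U a')⁻¹) * (φ (U a) * φ (U a')) -
        m * (κ ρ β (U a * (U a')⁻¹) * φ (U a)) - m * (κ ρ β (U a * (U a')⁻¹) * φ (U a')) +
        m ^ 2 * κ ρ β (U a * (U a')⁻¹) := funext fun U => by ring
  have i4 : Integrable (fun U : GaugeConfig 2 L G => m * (κ ρ β (U a * (U a')⁻¹) * φ (U a)))
      (linkMeasure L G) :=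
    iR1.const_mul m
  have i5 : Integrable (fun U : GaugeConfig 2 L G => m * (κ ρ β (U a * (U a')⁻¹) * φ (U a')))
      (linkMeasure L G) :=
    iR2.const_mul m
  have i3 : Integrable (fun U : GaugeConfig 2 L G => m ^ 2 * κ ρ β (U a * (U a')⁻¹)) (linkMeasure L
      G) :=
    iT.const_mul _
  have i1 : Integrable (fun U : GaugeConfig 2 L G => κ ρ β (U a * (U a')⁻¹) * (φ (U a) * φ (U a')) -
      m * (κ ρ β (U a * (U a')⁻¹) * φ (U a))) (linkMeasure L G) := iP.sub i4
  have i2 : Integrable (fun U : GaugeConfig 2 L G => κ ρ β (U a * (U a')⁻¹) * (φ (U a) * φ (U a')) -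
      m * (κ ρ β (U a * (U a')⁻¹) * φ (U a)) - m * (κ ρ β (U a * (U a')⁻¹) * φ (U a')))
          (linkMeasure L G) := i1.sub i5
  have hQ : ∫ U, κ ρ β (U a * (U a')⁻¹) * ((φ (U a) - m) * (φ (U a') - m)) ∂(linkMeasure L G) =
      Qφ - c₀ * m ^ 2 := by
    rw [hexp, integral_add i2 i3, integral_sub i1 i5, integral_sub iP i4, integral_const_mul,
      integral_const_mul, integral_const_mul, hR1, hR2, hT]
    ring
  rw [hQ]
  have hm2 : 0 < m ^ 2 := by positivity
  rcases hs with rfl | rfl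
  · nlinarith
  · nlinarith

end SignQ

end DiagRPTwo

end

end Summit.QuantumFields.GaugeBoot
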